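import Summits.NavierStokesRegularity.NavierStokesRegularity.Theorems.AxisymmetricExtremalityAxisymmetricKatoGlobalStubSeregin2020TypeIILemma22MoserIterationII
import Summits.NavierStokesRegularity.NavierStokesRegularity.Theorems.AxisTwistDoorAveragedConeLiouvilleNUMoserIterationIGen
import Summits.NavierStokesRegularity.NavierStokesRegularity.Theorems.AxisTwistDoorAveragedConeLiouvilleNULipDefs
import HarnessLib

/-!
# Nazarov–Uraltseva 2011, Cor. 3.1 (2): the Moser iteration `L31 ⇐ M1` ONCE over an ARBITRARY standing
# predicate `St Φ U k R N` (piece L31ᴸ⇐M1ᴸ (2/2: conclusion (ii), the combiner, and the instance over `NUStandingLip`) of the T1 programme of cell pub/ns-inputs; serves the classical chain over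
# `NUStanding`, the Lipschitz chain over `NUStandingLip`, and any later variant)

Route `AxisTwistDoor`, crux `AveragedConeLiouville` (stmt-NavierStokesRegularity-26889), INPUT N4 / T1 (the typed
Literature fact `NazarovUraltseva2011_positivity_propagation (EuclideanSpace ℝ (Fin 3))`), kit
`pub/ns-inputs/kits/N4-T1-skeleton.lean` 118454bf17607d1e, stub `stub_nuLip_smallSublevel_lowerBound_of_moserStep`
(«port `…NUMoserIteration*` verbatim, they never touch the slice clause»); seat ns-in-ser-a g3, announce
pub/ns-inputs STATUS 2026-08-28T13:52:58Z.

DESIGN. The landed iteration files (`…NUMoserIteration{{I,II,}}`, wu-341 g2, p631013/p631040/p631395 — themselves the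
axis-free twins of the A1 files `…Lemma22MoserIteration{{I,II,}}`) use the standing hypotheses ONLY through
`obtain ⟨-, hR, hΦm, -, -, hΦ0, -, -, -⟩ := hSt` and as a pass-through to the one-step estimate. Instead of a
third verbatim copy with `NUStanding ↦ NUStandingLip`, this file states the iteration over an arbitrary predicate
`St : (ℝ → ℝ³ → ℝ) → (ℝ → ℝ³ → ℝ³) → ℝ → ℝ → ℝ≥0 → Prop` together with the one projection it needs,
`St Φ U k R N → 0 < R ∧ Measurable (uncurry Φ) ∧ ∀ t x, 0 ≤ Φ t x`; the proof is the landed one VERBATIM with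
the destructuring line replaced by that projection (Moser bookkeeping over `…Lemma22MoserIterationTools` /
`moser_iterate_bound` / `ae_le_of_lintegral_rpow_le` BY NAME). Instances: `St := NUStandingLip` gives the kit's
`Sig.nuLip_moserStep → Sig.nuLip_smallSublevel_lowerBound` (file `…NUMoserIterationGen`).

## References
* A. I. Nazarov, N. N. Uraltseva, Algebra i Analiz 23:1 (2011) = St. Petersburg Math. J. 23 (2012) 93–115 =
  arXiv:1011.1888, §3, Lemma 3.1, Cor. 3.1 (2), Remark 6. [NazarovUraltseva2011HarnackDivFree] [NazarovUraltseva2012]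
* Z. Lei, X. Ren, G. Tian, arXiv:2501.08976, Lemma 2.5. [LeiRenTian2025]

WHAT THIS IS NOT: not a statement about Navier–Stokes regularity; one piece of the discharge of the NAMED fact
`NazarovUraltseva2011_positivity_propagation` (INPUT N4/T1); item 26889 and the summit stay open.
-/

-- the problem directory repeats the summit name (D-0017); core's `dupNamespace` linter fires
set_option linter.dupNamespace false

noncomputable section

open MeasureTheory Set Function Filter Topology TopologicalSpace Metric
open scoped NNReal ENNReal

namespace Summit.NavierStokesRegularity.NavierStokesRegularity.Theorems.AveragedConeLiouville.NU

open Literature.Analysis.FluidPDE Literature.Analysis.FluidPDE.Seregin2020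
open Summit.NavierStokesRegularity.NavierStokesRegularity.Theorems.AxisymmetricKatoGlobal.EulerScaling

set_option maxHeartbeats 800000 in
-- as in the A1 original (one long Moser-iteration bookkeeping proof)
/-- **N–U Lemma 3.1 / Cor 3.1 (2) with Remark 6, conclusion (ii), from the one-step estimate
M1 (ii).** See the module docstring. [cite: NazarovUraltseva2012, Lemma 3.1, Remark 6 and Cor 3.1 (2) (last statement)] -/
theorem nuGen_smallSublevel_lowerBound_ii_of_moserStep
    (St : (ℝ → EuclideanSpace ℝ (Fin 3) → ℝ) → (ℝ → EuclideanSpace ℝ (Fin 3) → EuclideanSpace ℝ (Fin 3)) →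
      ℝ → ℝ → ℝ≥0 → Prop)
    (hStP : ∀ Φ U k R N, St Φ U k R N → 0 < R ∧ Measurable (uncurry Φ) ∧ ∀ t x, 0 ≤ Φ t x)
    (hM1 : ∀ (N : ℝ≥0) (Θmax : ℝ), 0 < Θmax → ∃ C₀ A : ℝ, 0 ≤ C₀ ∧ 0 ≤ A ∧ ∀ (Φ : ℝ → EuclideanSpace ℝ (Fin 3) → ℝ) (U : ℝ → EuclideanSpace ℝ (Fin 3) → EuclideanSpace ℝ (Fin 3)) (k R : ℝ), St Φ U k R N → ∀ (ρ Λ₁ Λ₂ Θ₁ Θ₂ dl dθ t₀ l q : ℝ), R / 4 ≤ ρ → 1 ≤ Λ₂ → Λ₂ + dl ≤ Λ₁ → Λ₁ * ρ ≤ 2 * R → 0 < dl → dl ≤ 1 → 0 < Θ₂ → Θ₂ + dθ ≤ Θ₁ → Θ₁ ≤ Θmax → 0 < dθ → dθ ≤ 1 → t₀ ≤ 0 → -R ^ 2 < t₀ - Θ₁ * ρ ^ 2 → 0 < l → l ≤ k → 2 < q → (∫⁻ z in Ioo (t₀ - Θ₂ * ρ ^ 2) t₀ ×ˢ ball (0 :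 EuclideanSpace ℝ (Fin 3)) (Λ₂ * ρ), ENNReal.ofReal (max (l - Φ z.1 z.2) 0 ^ (5 / 3 * q)) ≤ ENNReal.ofReal (C₀ * (dl * dθ) ^ (-A) * ρ ^ (-(10 / 3 : ℝ))) * (∫⁻ z in Ioo (t₀ - Θ₁ * ρ ^ 2) t₀ ×ˢ ball (0 : EuclideanSpace ℝ (Fin 3)) (Λ₁ * ρ), ENNReal.ofReal (max (l - Φ z.1 z.2) 0 ^ q)) ^ (5 / 3 : ℝ)) ∧ ((∀ᵐ x ∂(volume.restrict (ball (0 : EuclideanSpace ℝ (Fin 3)) (Λ₁ * ρ))), l ≤ Φ (t₀ - Θ₁ * ρ ^ 2) x) → ∫⁻ z in Ioo (t₀ - Θ₁ * ρ ^ 2) t₀ ×ˢ ball (0 : EuclideanSpace ℝ (Fin 3)) (Λ₂ * ρ), ENNReal.ofReal (max (l - Φ z.1 z.2) 0 ^ (5 / 3 * q)) ≤ ENNReal.ofReal (C₀ * dl ^ (-A) * ρ ^ (-(10 / 3 : ℝ))) * (∫⁻ z in Ioo (t₀ - Θ₁ * ρ ^ 2) t₀ ×ˢ ball (0 : EuclideanSpace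 ℝ (Fin 3)) (Λ₁ * ρ), ENNReal.ofReal (max (l - Φ z.1 z.2) 0 ^ q)) ^ (5 / 3 : ℝ))) :
    ∀ (lamlo θlo θhi : ℝ) (N : ℝ≥0), 1 < lamlo → lamlo ≤ 2 → 0 < θlo → θlo ≤ θhi →
    ∃ μ₁ : ℝ, 0 < μ₁ ∧
    ∀ (Φ : ℝ → EuclideanSpace ℝ (Fin 3) → ℝ) (U : ℝ → EuclideanSpace ℝ (Fin 3) → EuclideanSpace ℝ (Fin 3))
      (k R : ℝ), St Φ U k R N →
    ∀ (lam ρ θ t₀ l : ℝ), lamlo ≤ lam → lam ≤ 2 → R / 4 ≤ ρ → lam * ρ ≤ 2 * R → θlo ≤ θ → θ ≤ θhi →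
      t₀ ≤ 0 → -R ^ 2 < t₀ - θ * ρ ^ 2 → 0 < l → l ≤ k →
      volume {z : ℝ × EuclideanSpace ℝ (Fin 3) |
          z ∈ Ioo (t₀ - θ * ρ ^ 2) t₀ ×ˢ ball (0 : EuclideanSpace ℝ (Fin 3)) (lam * ρ) ∧ Φ z.1 z.2 < l}
        ≤ ENNReal.ofReal μ₁ * volume (Ioo (t₀ - θ * ρ ^ 2) t₀ ×ˢ ball (0 : EuclideanSpace ℝ (Fin 3)) (lam * ρ)) →
      (∀ᵐ x ∂(volume.restrict (ball (0 : EuclideanSpace ℝ (Fin 3)) (lam * ρ))), l ≤ Φ (t₀ - θ * ρ ^ 2) x) →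
      ∀ᵐ z ∂(volume.restrict (Ioo (t₀ - θ * ρ ^ 2) t₀ ×ˢ ball (0 : EuclideanSpace ℝ (Fin 3)) ρ)),
        l / 2 ≤ Φ z.1 z.2 := by
  intro lamlo θlo θhi N hlamlo hlamlo2 hθlo hθlohi
  have hθhi : 0 < θhi := lt_of_lt_of_le hθlo hθlohi
  obtain ⟨C₀, A, hC₀, hA, hM⟩ := hM1 N θhi hθhi
  -- ### constants
  have hV0 : 0 < volume (ball (0 : EuclideanSpace ℝ (Fin 3)) 1) := measure_ball_pos volume 0 one_pos
  have hVtop : volume (ball (0 : EuclideanSpace ℝ (Fin 3)) 1) < ∞ := measure_ball_lt_top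
  obtain ⟨v, hv⟩ : ∃ x : ℝ, x = (volume (ball (0 : EuclideanSpace ℝ (Fin 3)) 1)).toReal := ⟨_, rfl⟩
  have hvpos : 0 < v := by rw [hv]; exact ENNReal.toReal_pos hV0.ne' hVtop.ne
  have hVeq : volume (ball (0 : EuclideanSpace ℝ (Fin 3)) 1) = ENNReal.ofReal v := by
    rw [hv, ENNReal.ofReal_toReal hVtop.ne]
  obtain ⟨c₁, hc₁⟩ : ∃ x : ℝ, x = (lamlo - 1) / 2 * min 1 (3 * θlo / 8) := ⟨_, rfl⟩
  have hc₁pos : 0 < c₁ := by rw [hc₁]; exact mul_pos (by linarith) (lt_min one_pos (by positivity))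
  obtain ⟨G, hG⟩ : ∃ x : ℝ, x = max 1 (C₀ * c₁ ^ (-A)) := ⟨_, rfl⟩
  have hG1 : 1 ≤ G := by rw [hG]; exact le_max_left _ _
  have hGC : C₀ * c₁ ^ (-A) ≤ G := by rw [hG]; exact le_max_right _ _
  obtain ⟨P, hP⟩ : ∃ x : ℝ, x = Real.exp (4 * (3 / 5 * (Real.log G + 4 * A * Real.log 8) / (5 / 2))) := ⟨_, rfl⟩
  have hPpos : 0 < P := by rw [hP]; exact Real.exp_pos _
  obtain ⟨μ₁, hμ₁⟩ : ∃ x : ℝ, x = (2 * P) ^ (-(5 / 2 : ℝ)) / (8 * θhi * v) := ⟨_, rfl⟩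
  have hμ₁pos : 0 < μ₁ := by rw [hμ₁]; positivity
  refine ⟨μ₁, hμ₁pos, ?_⟩
  -- ### data
  intro Φ U k R hSt lam ρ θ t₀ l hlam1 hlam2 hρ hlamρ hθ1 hθ2 ht₀ hbot hl hlk hsmall hbottom
  obtain ⟨hR, hΦm, hΦ0⟩ := hStP Φ U k R N hSt
  have hρpos : 0 < ρ := lt_of_lt_of_le (by positivity) hρ
  have hθpos : 0 < θ := lt_of_lt_of_le hθlo hθ1
  have hlam0 : 0 ≤ lam - 1 := by linarith
  -- exponents, radii, windows, gaps
  obtain ⟨q, hq⟩ : ∃ q : ℕ → ℝ, ∀ m, q m = 5 / 2 * (5 / 3 : ℝ) ^ m := ⟨_, fun _ => rfl⟩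
  have hqsucc : ∀ m, q (m + 1) = 5 / 3 * q m := fun m => by rw [hq, hq, pow_succ]; ring
  have hq2 : ∀ m, 2 < q m := fun m => by
    rw [hq]; have : (1 : ℝ) ≤ (5 / 3 : ℝ) ^ m := one_le_pow₀ (by norm_num); linarith
  obtain ⟨lamS, hlamS⟩ : ∃ f : ℕ → ℝ, ∀ m, f m = 1 + (lam - 1) * (1 / 2 : ℝ) ^ m := ⟨_, fun _ => rfl⟩
  obtain ⟨θS, hθS⟩ : ∃ f : ℕ → ℝ, ∀ m, f m = θ / 2 * (1 + (1 / 4 : ℝ) ^ m) := ⟨_, fun _ => rfl⟩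
  obtain ⟨dl, hdl⟩ : ∃ f : ℕ → ℝ, ∀ m, f m = (lam - 1) * (1 / 2 : ℝ) ^ (m + 1) := ⟨_, fun _ => rfl⟩
  obtain ⟨dθ, hdθ⟩ : ∃ f : ℕ → ℝ, ∀ m, f m = min 1 (3 * θ / 8 * (1 / 4 : ℝ) ^ m) := ⟨_, fun _ => rfl⟩
  have hpow2 : ∀ m, (0 : ℝ) < (1 / 2 : ℝ) ^ m := fun m => by positivity
  have hpow4 : ∀ m, (0 : ℝ) < (1 / 4 : ℝ) ^ m := fun m => by positivity
  have hpow2le : ∀ m, (1 / 2 : ℝ) ^ m ≤ 1 := fun m => pow_le_one₀ (by norm_num) (by norm_num)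
  have hpow4le : ∀ m, (1 / 4 : ℝ) ^ m ≤ 1 := fun m => pow_le_one₀ (by norm_num) (by norm_num)
  have hlamS1 : ∀ m, 1 ≤ lamS m := fun m => by rw [hlamS]; nlinarith [hpow2 m]
  have hlamSle : ∀ m, lamS m ≤ lam := fun m => by rw [hlamS]; nlinarith [hpow2le m]
  have hθSpos : ∀ m, 0 < θS m := fun m => by rw [hθS]; have := hpow4 m; positivity
  have hθSle : ∀ m, θS m ≤ θ := fun m => by rw [hθS]; nlinarith [hpow4le m]
  have hθSge : ∀ m, θ / 2 ≤ θS m := fun m => by rw [hθS]; nlinarith [hpow4 m]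
  have hdlpos : ∀ m, 0 < dl m := fun m => by
    rw [hdl]; exact mul_pos (by linarith) (by positivity)
  have hdl1 : ∀ m, dl m ≤ 1 := fun m => by
    rw [hdl]; have := pow_le_one₀ (n := m + 1) (by norm_num : (0:ℝ) ≤ 1/2) (by norm_num); nlinarith
  have hdθpos : ∀ m, 0 < dθ m := fun m => by rw [hdθ]; exact lt_min one_pos (by have := hpow4 m; positivity)
  have hdθ1 : ∀ m, dθ m ≤ 1 := fun m => by rw [hdθ]; exact min_le_left _ _
  have hgapl : ∀ m, lamS (m + 1) + dl m ≤ lamS m := fun m => by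
    rw [hlamS, hlamS, hdl, pow_succ]; linarith
  have hgapθ : ∀ m, θS (m + 1) + dθ m ≤ θS m := fun m => by
    rw [hθS, hθS, hdθ, pow_succ]
    have := min_le_right 1 (3 * θ / 8 * (1 / 4 : ℝ) ^ m)
    nlinarith [hpow4 m]
  -- the gap product is `≥ c₁ 8^{-m}`, hence `K_m ≤ G 8^{mA}`
  have hK : ∀ m : ℕ, C₀ * (dl m) ^ (-A) ≤ G * (8 : ℝ) ^ ((m : ℝ) * A) := by
    intro m
    have h8 : (0 : ℝ) < (1 / 8 : ℝ) ^ m := by positivity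
    have hprod : c₁ * (1 / 8 : ℝ) ^ m ≤ dl m := by
      have h82 : (1 / 8 : ℝ) ^ m ≤ (1 / 2 : ℝ) ^ m := pow_le_pow_left₀ (by norm_num) (by norm_num) m
      have hmin : min 1 (3 * θlo / 8) ≤ 1 := min_le_left _ _
      have hmin0 : 0 < min 1 (3 * θlo / 8) := lt_min one_pos (by positivity)
      rw [hc₁, hdl, pow_succ]
      have hl0 : 0 < (lamlo - 1) / 2 := by linarith
      calc (lamlo - 1) / 2 * min 1 (3 * θlo / 8) * (1 / 8 : ℝ) ^ m
          ≤ (lamlo - 1) / 2 * 1 * (1 / 2 : ℝ) ^ m :=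
            mul_le_mul (mul_le_mul_of_nonneg_left hmin hl0.le) h82 h8.le (by positivity)
        _ ≤ (lam - 1) * ((1 / 2 : ℝ) ^ m * (1 / 2)) := by nlinarith [hpow2 m]
    have hcpos : 0 < c₁ * (1 / 8 : ℝ) ^ m := by positivity
    have h1 : (dl m) ^ (-A) ≤ (c₁ * (1 / 8 : ℝ) ^ m) ^ (-A) :=
      Real.rpow_le_rpow_of_nonpos hcpos hprod (by linarith)
    have h2 : (c₁ * (1 / 8 : ℝ) ^ m) ^ (-A) = c₁ ^ (-A) * (8 : ℝ) ^ ((m : ℝ) * A) := by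
      rw [Real.mul_rpow hc₁pos.le h8.le]
      congr 1
      rw [← Real.rpow_natCast, ← Real.rpow_mul (by norm_num), show (1 / 8 : ℝ) = 8⁻¹ by norm_num,
        Real.inv_rpow (by norm_num), ← Real.rpow_neg (by norm_num)]
      ring_nf
    calc C₀ * (dl m) ^ (-A) ≤ C₀ * (c₁ ^ (-A) * (8 : ℝ) ^ ((m : ℝ) * A)) := by
          rw [← h2]; exact mul_le_mul_of_nonneg_left h1 hC₀
      _ = C₀ * c₁ ^ (-A) * (8 : ℝ) ^ ((m : ℝ) * A) := by ring
      _ ≤ G * (8 : ℝ) ^ ((m : ℝ) * A) := mul_le_mul_of_nonneg_right hGC (by positivity)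
  -- ### the integrals `I m` and the iteration
  obtain ⟨I, hI⟩ : ∃ I : ℕ → ℝ≥0∞, ∀ m, I m = ∫⁻ z in Ioo (t₀ - θ * ρ ^ 2) t₀ ×ˢ
      ball (0 : EuclideanSpace ℝ (Fin 3)) (lamS m * ρ), ENNReal.ofReal (max (l - Φ z.1 z.2) 0 ^ q m) :=
    ⟨_, fun _ => rfl⟩
  have hW : (0 : ℝ) < ρ ^ 5 := by positivity
  -- the step
  have hstep : ∀ m : ℕ, I (m + 1) ≤
      ENNReal.ofReal (G * (8 : ℝ) ^ ((m : ℝ) * A) * (ρ ^ 5) ^ (-(2 / 3 : ℝ))) * I m ^ (5 / 3 : ℝ) := by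
    intro m
    have hdθ0pos : 0 < min 1 (θ / 2) := lt_min one_pos (by linarith)
    have hbottom' : ∀ᵐ x ∂(volume.restrict (ball (0 : EuclideanSpace ℝ (Fin 3)) (lamS m * ρ))),
        l ≤ Φ (t₀ - θ * ρ ^ 2) x :=
      ae_restrict_of_ae_restrict_of_subset (ball_subset_ball (by nlinarith [hlamSle m, hρpos.le])) hbottom
    have h := (hM Φ U k R hSt ρ (lamS m) (lamS (m + 1)) θ (θ / 2) (dl m) (min 1 (θ / 2)) t₀ l (q m)
      hρ (hlamS1 (m + 1)) (hgapl m) (by nlinarith [hlamSle m, hρpos.le]) (hdlpos m) (hdl1 m) (by linarith)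
      (by linarith [min_le_right 1 (θ / 2)]) hθ2 hdθ0pos (min_le_left _ _) ht₀ hbot hl hlk (hq2 m)).2 hbottom'
    rw [hI (m + 1), hI m, hqsucc m]
    refine h.trans (mul_le_mul_of_nonneg_right (ENNReal.ofReal_le_ofReal ?_) bot_le)
    have e : (ρ ^ 5) ^ (-(2 / 3 : ℝ)) = ρ ^ (-(10 / 3 : ℝ)) := by
      rw [← Real.rpow_natCast, ← Real.rpow_mul hρpos.le]; norm_num
    rw [e]
    exact mul_le_mul_of_nonneg_right (hK m) (by positivity)
  -- the start
  have hlampos : 0 < lam := by linarith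
  have hvolQ : volume (Ioo (t₀ - θ * ρ ^ 2) t₀ ×ˢ ball (0 : EuclideanSpace ℝ (Fin 3)) (lam * ρ))
      ≤ ENNReal.ofReal (8 * θhi * v * ρ ^ 5) := by
    have h3 : Module.finrank ℝ (EuclideanSpace ℝ (Fin 3)) = 3 := by simp
    have h1 : t₀ - (t₀ - θ * ρ ^ 2) = θ * ρ ^ 2 := by ring
    have hlamρ0 : 0 ≤ lam * ρ := by positivity
    rw [Measure.volume_eq_prod, Measure.prod_prod, Real.volume_Ioo, h1,
      Measure.addHaar_ball volume 0 hlamρ0, h3, hVeq,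
      ← ENNReal.ofReal_mul (by positivity), ← ENNReal.ofReal_mul (by positivity)]
    refine ENNReal.ofReal_le_ofReal ?_
    have h2 : lam ^ 3 ≤ 2 ^ 3 := pow_le_pow_left₀ hlampos.le hlam2 3
    have h4 : (lam * ρ) ^ 3 ≤ 8 * ρ ^ 3 := by
      rw [mul_pow]; exact mul_le_mul_of_nonneg_right (by linarith) (by positivity)
    have h5 : θ * ρ ^ 2 ≤ θhi * ρ ^ 2 := mul_le_mul_of_nonneg_right hθ2 (by positivity)
    calc θ * ρ ^ 2 * ((lam * ρ) ^ 3 * v) ≤ θhi * ρ ^ 2 * (8 * ρ ^ 3 * v) :=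
          mul_le_mul h5 (mul_le_mul_of_nonneg_right h4 hvpos.le) (by positivity) (by positivity)
      _ = 8 * θhi * v * ρ ^ 5 := by ring
  have hstart : I 0 ≤ ENNReal.ofReal (ρ ^ 5 * (l ^ (5 / 2 : ℝ) * μ₁ * (8 * θhi * v))) := by
    rw [hI 0]
    have e1 : lamS 0 = lam := by rw [hlamS, pow_zero]; ring
    have e2 : q 0 = 5 / 2 := by rw [hq, pow_zero, mul_one]
    rw [e1, e2]
    set Q : Set (ℝ × EuclideanSpace ℝ (Fin 3)) := Ioo (t₀ - θ * ρ ^ 2) t₀ ×ˢ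
      ball (0 : EuclideanSpace ℝ (Fin 3)) (lam * ρ) with hQ
    have hLm : MeasurableSet {z : ℝ × EuclideanSpace ℝ (Fin 3) | Φ z.1 z.2 < l} :=
      measurableSet_lt hΦm measurable_const
    have hle : ∀ z, ENNReal.ofReal (max (l - Φ z.1 z.2) 0 ^ (5 / 2 : ℝ)) ≤
        {z : ℝ × EuclideanSpace ℝ (Fin 3) | Φ z.1 z.2 < l}.indicator (fun _ => ENNReal.ofReal (l ^ (5 / 2 : ℝ))) z := by
      intro z
      by_cases hz : Φ z.1 z.2 < l
      · rw [indicator_of_mem (show z ∈ {z : ℝ × EuclideanSpace ℝ (Fin 3) | Φ z.1 z.2 < l} from hz)]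
        refine ENNReal.ofReal_le_ofReal (Real.rpow_le_rpow (le_max_right _ _) ?_ (by norm_num))
        exact max_le (by linarith [hΦ0 z.1 z.2]) hl.le
      · rw [indicator_of_notMem (show z ∉ {z : ℝ × EuclideanSpace ℝ (Fin 3) | Φ z.1 z.2 < l} from hz),
          max_eq_right (by linarith), Real.zero_rpow (by norm_num), ENNReal.ofReal_zero]
    calc ∫⁻ z in Q, ENNReal.ofReal (max (l - Φ z.1 z.2) 0 ^ (5 / 2 : ℝ))
        ≤ ∫⁻ z in Q, {z : ℝ × EuclideanSpace ℝ (Fin 3) | Φ z.1 z.2 < l}.indicator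
            (fun _ => ENNReal.ofReal (l ^ (5 / 2 : ℝ))) z := lintegral_mono fun z => hle z
      _ = ENNReal.ofReal (l ^ (5 / 2 : ℝ)) * volume ({z : ℝ × EuclideanSpace ℝ (Fin 3) | Φ z.1 z.2 < l} ∩ Q) := by
          rw [lintegral_indicator hLm, setLIntegral_const, Measure.restrict_apply hLm]
      _ ≤ ENNReal.ofReal (l ^ (5 / 2 : ℝ)) * (ENNReal.ofReal μ₁ * volume Q) := by
          refine mul_le_mul_of_nonneg_left ?_ bot_le
          refine le_trans (measure_mono fun z hz => ?_) hsmall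
          exact ⟨hz.2, hz.1⟩
      _ ≤ ENNReal.ofReal (l ^ (5 / 2 : ℝ)) * (ENNReal.ofReal μ₁ * ENNReal.ofReal (8 * θhi * v * ρ ^ 5)) :=
          mul_le_mul_of_nonneg_left (mul_le_mul_of_nonneg_left hvolQ bot_le) bot_le
      _ = ENNReal.ofReal (ρ ^ 5 * (l ^ (5 / 2 : ℝ) * μ₁ * (8 * θhi * v))) := by
          rw [← ENNReal.ofReal_mul hμ₁pos.le, ← ENNReal.ofReal_mul (by positivity)]
          congr 1; ring
  have hX₀ : 0 < l ^ (5 / 2 : ℝ) * μ₁ * (8 * θhi * v) := by positivity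
  have hiter := moser_iterate_bound hW hX₀ hG1 hA hstart hstep
  -- ### the inner cylinder and the a.e. bound
  set E : Set (ℝ × EuclideanSpace ℝ (Fin 3)) := Ioo (t₀ - θ * ρ ^ 2) t₀ ×ˢ
    ball (0 : EuclideanSpace ℝ (Fin 3)) ρ with hE
  have hEsub : ∀ m, E ⊆ Ioo (t₀ - θ * ρ ^ 2) t₀ ×ˢ ball (0 : EuclideanSpace ℝ (Fin 3)) (lamS m * ρ) := by
    intro m
    refine prod_mono Subset.rfl (ball_subset_ball ?_)
    nlinarith [hlamS1 m, hρpos]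
  set M : ℝ := P * (l ^ (5 / 2 : ℝ) * μ₁ * (8 * θhi * v)) ^ (1 / (5 / 2 : ℝ)) with hMdef
  have hMpos : 0 < M := by rw [hMdef]; positivity
  have hbound : ∀ m, ∫⁻ z in E, ENNReal.ofReal (max (l - Φ z.1 z.2) 0 ^ q m) ≤
      ENNReal.ofReal (ρ ^ 5 * M ^ q m) := by
    intro m
    refine (lintegral_mono_set (hEsub m)).trans ?_
    have h := hiter m
    rw [← hP] at h
    rw [← hI m, hMdef, hq m]
    exact h
  have hqge : ∀ m, 1 ≤ q m := fun m => by linarith [hq2 m]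
  have hqtop : Tendsto q atTop atTop := by
    have h1 : Tendsto (fun m : ℕ => (5 / 3 : ℝ) ^ m) atTop atTop := tendsto_pow_atTop_atTop_of_one_lt (by norm_num)
    have h2 := h1.const_mul_atTop (by norm_num : (0 : ℝ) < 5 / 2)
    refine h2.congr fun m => ?_
    rw [hq]
  have hu : AEMeasurable (fun z : ℝ × EuclideanSpace ℝ (Fin 3) => max (l - Φ z.1 z.2) 0) (volume.restrict E) :=
    ((measurable_const.sub hΦm).max measurable_const).aemeasurable
  have hae := ae_le_of_lintegral_rpow_le (μ := volume.restrict E) hu hMpos hqge hqtop hbound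
  -- `M = l/2`
  have hM : M = l / 2 := by
    have h2P : 0 < 2 * P := by positivity
    have hX : l ^ (5 / 2 : ℝ) * μ₁ * (8 * θhi * v) = (l * (2 * P)⁻¹) ^ (5 / 2 : ℝ) := by
      rw [hμ₁, mul_assoc, div_mul_cancel₀ _ (by positivity : (8 * θhi * v) ≠ 0),
        Real.mul_rpow hl.le (inv_nonneg.2 h2P.le), Real.inv_rpow h2P.le, Real.rpow_neg h2P.le]
    rw [hMdef, hX, ← Real.rpow_mul (by positivity), show (5 / 2 : ℝ) * (1 / (5 / 2)) = 1 by norm_num,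
      Real.rpow_one]
    field_simp
  filter_upwards [hae] with z hz
  rw [hM] at hz
  have := le_max_left (l - Φ z.1 z.2) 0
  linarith

/-- **L31 from M1 over an arbitrary standing predicate `St`** (both conclusions; `μ₁ = min μ₁⁽ⁱ⁾ μ₁⁽ⁱⁱ⁾`): the
classical `nu_smallSublevel_lowerBound_of_moserStep` (p631395) is the instance `St := NUStanding`, the Lipschitz one
below is `St := NUStandingLip`.
[cite: NazarovUraltseva2011HarnackDivFree, §3 Lemma 3.1; NazarovUraltseva2012, Lemma 3.1, Cor 3.1 (2), Remark 6] -/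
theorem nuGen_smallSublevel_lowerBound_of_moserStep
    (St : (ℝ → EuclideanSpace ℝ (Fin 3) → ℝ) → (ℝ → EuclideanSpace ℝ (Fin 3) → EuclideanSpace ℝ (Fin 3)) →
      ℝ → ℝ → ℝ≥0 → Prop)
    (hStP : ∀ Φ U k R N, St Φ U k R N → 0 < R ∧ Measurable (uncurry Φ) ∧ ∀ t x, 0 ≤ Φ t x)
    (hM1 : ∀ (N : ℝ≥0) (Θmax : ℝ), 0 < Θmax → ∃ C₀ A : ℝ, 0 ≤ C₀ ∧ 0 ≤ A ∧ ∀ (Φ : ℝ → EuclideanSpace ℝ (Fin 3) → ℝ) (U : ℝ → EuclideanSpace ℝ (Fin 3) → EuclideanSpace ℝ (Fin 3)) (k R : ℝ), St Φ U k R N → ∀ (ρ Λ₁ Λ₂ Θ₁ Θ₂ dl dθ t₀ l q : ℝ), R / 4 ≤ ρ → 1 ≤ Λ₂ → Λ₂ + dl ≤ Λ₁ → Λ₁ * ρ ≤ 2 * R → 0 < dl → dl ≤ 1 → 0 < Θ₂ → Θ₂ + dθ ≤ Θ₁ → Θ₁ ≤ Θmax → 0 < dθ → dθ ≤ 1 →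 t₀ ≤ 0 → -R ^ 2 < t₀ - Θ₁ * ρ ^ 2 → 0 < l → l ≤ k → 2 < q → (∫⁻ z in Ioo (t₀ - Θ₂ * ρ ^ 2) t₀ ×ˢ ball (0 : EuclideanSpace ℝ (Fin 3)) (Λ₂ * ρ), ENNReal.ofReal (max (l - Φ z.1 z.2) 0 ^ (5 / 3 * q)) ≤ ENNReal.ofReal (C₀ * (dl * dθ) ^ (-A) * ρ ^ (-(10 / 3 : ℝ))) * (∫⁻ z in Ioo (t₀ - Θ₁ * ρ ^ 2) t₀ ×ˢ ball (0 : EuclideanSpace ℝ (Fin 3)) (Λ₁ * ρ), ENNReal.ofReal (max (l - Φ z.1 z.2) 0 ^ q)) ^ (5 / 3 : ℝ)) ∧ ((∀ᵐ x ∂(volume.restrict (ball (0 : EuclideanSpace ℝ (Fin 3)) (Λ₁ * ρ))), l ≤ Φ (t₀ - Θ₁ * ρ ^ 2) x) → ∫⁻ z in Ioo (t₀ - Θ₁ * ρ ^ 2) t₀ ×ˢ ball (0 : EuclideanSpace ℝ (Fin 3)) (Λ₂ * ρ), ENNReal.ofReal (max (l - Φ z.1 z.2) 0 ^ (5 / 3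 * q)) ≤ ENNReal.ofReal (C₀ * dl ^ (-A) * ρ ^ (-(10 / 3 : ℝ))) * (∫⁻ z in Ioo (t₀ - Θ₁ * ρ ^ 2) t₀ ×ˢ ball (0 : EuclideanSpace ℝ (Fin 3)) (Λ₁ * ρ), ENNReal.ofReal (max (l - Φ z.1 z.2) 0 ^ q)) ^ (5 / 3 : ℝ))) :
    ∀ (lamlo θlo θhi : ℝ) (N : ℝ≥0), 1 < lamlo → lamlo ≤ 2 → 0 < θlo → θlo ≤ θhi → ∃ μ₁ : ℝ, 0 < μ₁ ∧ ∀ (Φ : ℝ → EuclideanSpace ℝ (Fin 3) → ℝ) (U : ℝ → EuclideanSpace ℝ (Fin 3) → EuclideanSpace ℝ (Fin 3)) (k R : ℝ), St Φ U k R N → ∀ (lam ρ θ t₀ l : ℝ), lamlo ≤ lam → lam ≤ 2 → R / 4 ≤ ρ → lam * ρ ≤ 2 * R → θlo ≤ θ → θ ≤ θhi → t₀ ≤ 0 → -R ^ 2 < t₀ - θ * ρ ^ 2 → 0 < l → l ≤ k → volume {z : ℝ × EuclideanSpace ℝ (Fin 3) | z ∈ Ioo (t₀ - θ * ρ ^ 2)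 t₀ ×ˢ ball (0 : EuclideanSpace ℝ (Fin 3)) (lam * ρ) ∧ Φ z.1 z.2 < l} ≤ ENNReal.ofReal μ₁ * volume (Ioo (t₀ - θ * ρ ^ 2) t₀ ×ˢ ball (0 : EuclideanSpace ℝ (Fin 3)) (lam * ρ)) → (∀ᵐ z ∂(volume.restrict (Ioo (t₀ - θ / 2 * ρ ^ 2) t₀ ×ˢ ball (0 : EuclideanSpace ℝ (Fin 3)) ρ)), l / 2 ≤ Φ z.1 z.2) ∧ ((∀ᵐ x ∂(volume.restrict (ball (0 : EuclideanSpace ℝ (Fin 3)) (lam * ρ))), l ≤ Φ (t₀ - θ * ρ ^ 2) x) → ∀ᵐ z ∂(volume.restrict (Ioo (t₀ - θ * ρ ^ 2) t₀ ×ˢ ball (0 : EuclideanSpace ℝ (Fin 3)) ρ)), l / 2 ≤ Φ z.1 z.2) := by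
  intro lamlo θlo θhi N hlamlo hlamlo2 hθlo hθlohi
  obtain ⟨μa, hμa, ha⟩ := nuGen_smallSublevel_lowerBound_i_of_moserStep St hStP hM1 lamlo θlo θhi N hlamlo hlamlo2 hθlo hθlohi
  obtain ⟨μb, hμb, hb⟩ := nuGen_smallSublevel_lowerBound_ii_of_moserStep St hStP hM1 lamlo θlo θhi N hlamlo hlamlo2 hθlo hθlohi
  refine ⟨min μa μb, lt_min hμa hμb, ?_⟩
  intro Φ U k R hSt lam ρ θ t₀ l hlam1 hlam2 hρ hlamρ hθ1 hθ2 ht₀ hbot hl hlk hsmall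
  have hsa := hsmall.trans (mul_le_mul_of_nonneg_right (ENNReal.ofReal_le_ofReal (min_le_left μa μb)) bot_le)
  have hsb := hsmall.trans (mul_le_mul_of_nonneg_right (ENNReal.ofReal_le_ofReal (min_le_right μa μb)) bot_le)
  exact ⟨ha Φ U k R hSt lam ρ θ t₀ l hlam1 hlam2 hρ hlamρ hθ1 hθ2 ht₀ hbot hl hlk hsa,
    hb Φ U k R hSt lam ρ θ t₀ l hlam1 hlam2 hρ hlamρ hθ1 hθ2 ht₀ hbot hl hlk hsb⟩


open Summit.NavierStokesRegularity.NavierStokesRegularity.Theorems.AveragedConeLiouville.NUPositivity in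
/-- **T1 piece L31ᴸ ⇐ M1ᴸ = the kit's `stub_nuLip_smallSublevel_lowerBound_of_moserStep` (N4-T1-skeleton
118454bf17607d1e): `Sig.nuLip_moserStep → Sig.nuLip_smallSublevel_lowerBound`** over the tree defs `…NULipDefs`
(p638908) — the instance `St := NUStandingLip` of `nuGen_smallSublevel_lowerBound_of_moserStep`.
[cite: NazarovUraltseva2011HarnackDivFree, §3 Lemma 3.1; NazarovUraltseva2012, Lemma 3.1, Cor 3.1 (2), Remark 6] -/
theorem nuLip_smallSublevel_lowerBound_of_moserStep :
    Sig.nuLip_moserStep → Sig.nuLip_smallSublevel_lowerBound := fun hM1 =>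
  nuGen_smallSublevel_lowerBound_of_moserStep NUStandingLip
    (fun _ _ _ _ _ h => ⟨h.2.1, h.2.2.1, h.2.2.2.2.2.1⟩) hM1

open Summit.NavierStokesRegularity.NavierStokesRegularity.Theorems.AveragedConeLiouville.NUPositivity in
/-- Landing check: the type is literally the kit's stub text. -/
example : Sig.nuLip_moserStep → Sig.nuLip_smallSublevel_lowerBound :=
  nuLip_smallSublevel_lowerBound_of_moserStep

end Summit.NavierStokesRegularity.NavierStokesRegularity.Theorems.AveragedConeLiouville.NU

end
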